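import Summits.ABC.ABC.Theorems.IsogenyGlueCongruenceEllipticGluingPrimeBoundStubCMTorsionCoreOfAux5
import Summits.ABC.ABC.Theorems.IsogenyGlueCongruenceEllipticGluingPrimeBoundStubCMTorsionCoreOfAux6
import Summits.ABC.ABC.Theorems.IsogenyGlueCongruenceEllipticGluingPrimeBoundStubCMTorsionCoreOfAux7
import Summits.ABC.ABC.Theorems.IsogenyGlueCongruenceEllipticGluingPrimeBoundStubCMTorsionCoreOfAux8
import Summits.ABC.ABC.Theorems.IsogenyGlueCongruenceEllipticGluingPrimeBoundStubCMIsotypicCoreOfAux2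
import HarnessLib

/-!
# Crux `EllipticGluingPrimeBound`, line Sketch — stub `stub_CMTorsionCoreOf` ((K†), CM torsion core)

Stub `stub_CMTorsionCoreOf` of line `Sketch` (isotypic–Minkowski reduction) of crux U
`Summit.ABC.ABC.Theses.IsogenyGlueCongruence.EllipticGluingPrimeBound` (item stmt-ABC-13919),
registered signature (namespace `Summit.ABC.ABC.Theorems.IsotypicMinkowski`).

**Statement.** Granted Faltings' theorem for pairs of abelian varieties over `ℚ` (`hFal`, the
tree's named fact `faltings_tate_bijective`) and FACT 2 (`hF2`, the main theorem of complex
multiplication read on `ℓ`-torsion: `φ = √D` on `W[ℓ]`, the quadratic character `χ`, the Cartan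
clause), there are `L₀` and `c` (`= 385`) such that for every elliptic curve `W/ℚ` with CM and
AV-model `E` (`e : E(ℚ̄) ≃+ W(ℚ̄)` equivariant), every `ℚ`-free geometrically `E`-isotypic `A/ℚ`
and every prime `ℓ > L₀` with `W[ℓ] ↪ A(ℚ̄)` equivariantly: either some finite subgroup
`G ≤ GL_r(ℤ)`, `r ≤ 4 dim A`, has `ℓ ∣ |G|` (the Galois image on `Hom(E_ℚ̄, A_ℚ̄)`; Minkowski's
input), or `ℓ ≤ c (dim A + 1)²`.

**Proof.** As in the big-image core: the Hom-lattice `H = Hom(E_ℚ̄, A_ℚ̄)` with its finite Galois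
image `G` (`BigImage.homGaloisLattice'`); if `ℓ ∣ |G|`, Minkowski's disjunct. Else FACT 2 is
transported to `V = E[ℓ]` along `e`; `V` is irreducible (the line's
`CMIsotypicCore.irreducible_of_cmCartanImage`), so the torsion filtration
(`exists_stable_onto_torsion`) cuts `W[ℓ] ↪ A[ℓ]` down to an equivariant quotient of a stable
`ℓ`-torsion `S ≤ E(ℚ̄)^r`; averaging over the finite prime-to-`ℓ` image of `Γ_K = ker χ`
(`exists_equivariant_injective`, helpers 6/8; no unipotents in the Cartan, helpers 2/8) gives an
injective `Γ_K`-equivariant `j : V → V^r`, and the dichotomy `fixed_or_le` (helpers 3–5/8: the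
eigen-computation over `𝔽̄_ℓ` and the `θ`-count `φ(N) ≤ r`, `ℓ ≤ 12 N + 1`, `N ≤ 2 φ(N)²`) yields
`ℓ ≤ 24 r² + 1 ≤ 385 (dim A + 1)²` or a non-zero `Γ_K`-fixed vector of `H/ℓH`; the latter lifts
to a `χ`-eigenvector `f ≠ 0` in `H` (helpers 2/8), which the Faltings step
(`false_of_eigenvector`, helpers 8/8) excludes, using the CM endomorphism `ψ` of `W` (helpers 7/8)
transported to `E(ℚ̄)` along `e` — its character IS FACT 2's `χ` (`units_eq_of_nonscalar`,
helpers 3/8, as `ψ` is non-scalar on `W[ℓ]`).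

Deliberately NOT here: no definitions, no named fact; the composition with Minkowski and the
rational-part reduction (`stub_CMIsotypicCoreOf`, a neighbouring stub of the line).
-/

noncomputable section

-- `Summit.<Summit>.<Problem>` is the mandated summit-side namespace (CONVENTIONS §2); for the
-- single-conjunct summit `ABC` the two coincide, so the duplicate `ABC.ABC` is deliberate.
set_option linter.dupNamespace false

namespace Summit.ABC.ABC.Theorems.IsotypicMinkowski

open scoped AddSubgroup Matrix

open CategoryTheory CategoryTheory.Limits AlgebraicGeometry
open Literature.AlgebraicGeometry.Motives
open Summit.ABC.ABC.Theses.IsogenyGlueCongruence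

/-! ## The stub -/

/-- **(K†) = `stub_CMTorsionCoreOf`: the CM torsion core.** With `L₀ = max L₁ (max L₂ 29)` (`L₁`
from FACT 2, `L₂` from the irreducibility it implies) and `c = 385`: for `W/ℚ` with CM, a `ℚ`-free
geometrically `E`-isotypic `A/ℚ` carrying `W[ℓ] ↪ A(ℚ̄)` equivariantly at a prime `ℓ > L₀` has
either a Galois image of order divisible by `ℓ` on the Hom-lattice `Hom(E_ℚ̄, A_ℚ̄)` (rank
`≤ 4 dim A`) or `ℓ ≤ 385 (dim A + 1)²`. Conditional exactly on its two hypotheses: Faltings'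
theorem `faltings_tate_bijective` over `ℚ` (used once, in `false_of_eigenvector`) and FACT 2 (the
main theorem of complex multiplication on `ℓ`-torsion). -/
theorem stub_CMTorsionCoreOf
    (hFal : ∀ (A B : AbelianVariety.{0} ℚ) (ℓ : ℕ) [Fact ℓ.Prime],
      Literature.AlgebraicGeometry.Motives.faltings_tate_bijective A B ℓ)
    (hF2 : ∃ L₀ : ℕ, ∀ (W : WeierstrassCurve ℚ) [W.IsElliptic], W.HasCM → ∀ ℓ : ℕ, ℓ.Prime → L₀ < ℓ →
      ∃ (φ : AddMonoid.End (W.geomTorsion ℓ)) (D : ℤ) (χ : Field.absoluteGaloisGroup ℚ →* ℤˣ),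
        (∀ P : W.geomTorsion ℓ, φ (φ P) = D • P) ∧ ¬ (ℓ : ℤ) ∣ D ∧
        (∀ c : ℤ, ∃ P : W.geomTorsion ℓ, φ P ≠ c • P) ∧
        (∃ σ : Field.absoluteGaloisGroup ℚ, χ σ ≠ 1) ∧
        (∀ (σ : Field.absoluteGaloisGroup ℚ) (P : W.geomTorsion ℓ),
          φ (σ • P) = ((χ σ : ℤˣ) : ℤ) • σ • φ P) ∧
        (∀ a b : ℤ, ¬ (ℓ : ℤ) ∣ a ^ 2 - D * b ^ 2 →
          ∃ σ : Field.absoluteGaloisGroup ℚ, χ σ = 1 ∧ ∀ P : W.geomTorsion ℓ,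
            σ • P = (((a : AddMonoid.End (W.geomTorsion ℓ)) +
              (b : AddMonoid.End (W.geomTorsion ℓ)) * φ) ^ 12) P)) :
    ∃ (L₀ : ℕ) (c : ℝ), ∀ (W : WeierstrassCurve ℚ) [W.IsElliptic] (E A : AbelianVariety.{0} ℚ)
      (e : E.geomPoints ≃+ W.geomPoints),
      (∀ (σ : Field.absoluteGaloisGroup ℚ) (P : E.geomPoints), e (σ • P) = σ • e P) →
      W.HasCM →
      (∀ (C : AbelianVariety.{0} (AlgebraicClosure ℚ))
          (g : A.baseChange (AlgebraicClosure ℚ) ⟶ C),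
          Surjective (AbelianVariety.Hom.toSchemeHom g) → C.dim ≠ 0 →
          ∃ f : E.baseChange (AlgebraicClosure ℚ) ⟶ C, f ≠ 0) →
      (∀ f : E ⟶ A, f = 0) →
      ∀ ℓ : ℕ, ℓ.Prime → L₀ < ℓ →
      (∃ ι : W.geomTorsion ℓ →+ A.geomPoints, Function.Injective ι ∧
        ∀ (σ : Field.absoluteGaloisGroup ℚ) (P : W.geomTorsion ℓ), ι (σ • P) = σ • ι P) →
        (∃ (r : ℕ) (G : Subgroup (Matrix.GeneralLinearGroup (Fin r) ℤ)),
          r ≤ 4 * A.dim ∧ Finite G ∧ ℓ ∣ Nat.card G) ∨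
        (ℓ : ℝ) ≤ c * ((A.dim : ℝ) + 1) ^ 2 := by
  classical
  obtain ⟨L₂, hirrW⟩ := CMIsotypicCore.irreducible_of_cmCartanImage hF2
  obtain ⟨L₁, hF2⟩ := hF2
  refine ⟨max L₁ (max L₂ 29), 385, ?_⟩
  intro W _ E A e he hCM hiso hfree ℓ hℓ hL hι
  have hL₁ : L₁ < ℓ := lt_of_le_of_lt (le_max_left _ _) hL
  have hL₂ : L₂ < ℓ := lt_of_le_of_lt ((le_max_left _ _).trans (le_max_right _ _)) hL
  have h29 : 29 < ℓ := lt_of_le_of_lt ((le_max_right _ _).trans (le_max_right _ _)) hL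
  obtain ⟨ι, hιinj, hισ⟩ := hι
  haveI : Fact ℓ.Prime := ⟨hℓ⟩
  have hℓ2 : ℓ ≠ 2 := by omega
  -- FACT 2 at `ℓ`, on `W[ℓ]`
  obtain ⟨φW, D, χ, hφφW, hD, hnsW, hχ, hsemiW, hbigW⟩ := hF2 W hCM ℓ hℓ hL₁
  -- the Hom-lattice
  obtain ⟨hfreeZ, hfinZ, hrank, ρ, hρ, hfin, hfix⟩ := BigImage.homGaloisLattice' E A
  haveI := hfreeZ
  haveI := hfinZ
  have hE1 : E.dim = 1 := dim_eq_one_of_equiv e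
  -- the restriction of `e` to the `ℓ`-torsion
  let eℓ : E.geomTorsion ℓ ≃+ W.geomTorsion ℓ :=
    { e.toEquiv.subtypeEquiv fun P ↦ (map_mem_geomTorsion_iff e ℓ P).symm with
      map_add' := fun x y ↦ Subtype.ext (map_add e (x : E.geomPoints) (y : E.geomPoints)) }
  have heℓ : ∀ x : E.geomTorsion ℓ, ((eℓ x : W.geomTorsion ℓ) : W.geomPoints) = e x := fun x ↦ rfl
  have heℓσ : ∀ (σ : Field.absoluteGaloisGroup ℚ) (x : E.geomTorsion ℓ), eℓ (σ • x) = σ • eℓ x :=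
    fun σ x ↦ Subtype.ext (by
      rw [heℓ, Literature.NumberTheory.EllipticCurves.AddSubgroup.torsionBy.coe_smul,
        Literature.NumberTheory.EllipticCurves.AddSubgroup.torsionBy.coe_smul, heℓ, he])
  have heℓσ' : ∀ (σ : Field.absoluteGaloisGroup ℚ) (y : W.geomTorsion ℓ),
      eℓ.symm (σ • y) = σ • eℓ.symm y := fun σ y ↦ by
    apply eℓ.injective
    rw [heℓσ, eℓ.apply_symm_apply, eℓ.apply_symm_apply]
  -- `#W[ℓ] = #E[ℓ] = ℓ²`
  have hcardW : Nat.card (W.geomTorsion ℓ) = ℓ ^ 2 := by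
    have h := Literature.NumberTheory.EllipticCurves.natCard_geomTorsion_int_eq_sq W
      (n := (ℓ : ℤ)) (by exact_mod_cast hℓ.ne_zero)
    rwa [Int.natAbs_natCast] at h
  have hcard : Nat.card (E.geomTorsion ℓ) = ℓ ^ 2 := by
    rw [Nat.card_congr eℓ.toEquiv, hcardW]
  -- FACT 2 transported to `V = E[ℓ]`
  let κ : AddMonoid.End (W.geomTorsion ℓ) →+* AddMonoid.End (E.geomTorsion ℓ) :=
    { toFun := fun g ↦ eℓ.symm.toAddMonoidHom.comp (g.comp eℓ.toAddMonoidHom)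
      map_one' := by
        refine AddMonoidHom.ext fun v ↦ ?_
        change eℓ.symm ((1 : AddMonoid.End (W.geomTorsion ℓ)) (eℓ v)) = v
        rw [AddMonoid.End.one_apply, eℓ.symm_apply_apply]
      map_mul' := fun g g' ↦ by
        refine AddMonoidHom.ext fun v ↦ ?_
        change eℓ.symm (g (g' (eℓ v))) = eℓ.symm (g (eℓ (eℓ.symm (g' (eℓ v)))))
        rw [eℓ.apply_symm_apply]
      map_zero' := by
        refine AddMonoidHom.ext fun v ↦ ?_
        change eℓ.symm ((0 : AddMonoid.End (W.geomTorsion ℓ)) (eℓ v)) = 0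
        rw [AddMonoid.End.zero_apply, map_zero]
      map_add' := fun g g' ↦ by
        refine AddMonoidHom.ext fun v ↦ ?_
        change eℓ.symm (g (eℓ v) + g' (eℓ v)) = eℓ.symm (g (eℓ v)) + eℓ.symm (g' (eℓ v))
        rw [map_add] }
  have hκ : ∀ (g : AddMonoid.End (W.geomTorsion ℓ)) (v : E.geomTorsion ℓ),
      κ g v = eℓ.symm (g (eℓ v)) := fun _ _ ↦ rfl
  set φ : AddMonoid.End (E.geomTorsion ℓ) := κ φW with hφ_def
  have hφ : ∀ v, φ v = eℓ.symm (φW (eℓ v)) := fun v ↦ hκ φW v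
  have hφφ : ∀ v, φ (φ v) = D • v := fun v ↦ by
    rw [hφ, hφ, eℓ.apply_symm_apply, hφφW, map_zsmul, eℓ.symm_apply_apply]
  have hns : ∀ c : ℤ, ∃ v, φ v ≠ c • v := fun c ↦ by
    obtain ⟨P, hP⟩ := hnsW c
    refine ⟨eℓ.symm P, fun h ↦ hP ?_⟩
    rw [hφ, eℓ.apply_symm_apply, ← map_zsmul] at h
    exact eℓ.symm.injective h
  have hsemi : ∀ (σ : Field.absoluteGaloisGroup ℚ) (v : E.geomTorsion ℓ),
      φ (σ • v) = ((χ σ : ℤˣ) : ℤ) • σ • φ v := fun σ v ↦ by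
    rw [hφ, hφ, heℓσ, hsemiW, map_zsmul, heℓσ']
  have hbig : ∀ a b : ℤ, ¬ (ℓ : ℤ) ∣ a ^ 2 - D * b ^ 2 → ∃ σ : Field.absoluteGaloisGroup ℚ,
      χ σ = 1 ∧ ∀ v : E.geomTorsion ℓ, σ • v = (((a : AddMonoid.End (E.geomTorsion ℓ)) +
        (b : AddMonoid.End (E.geomTorsion ℓ)) * φ) ^ 12) v := fun a b hab ↦ by
    obtain ⟨σ, hσ1, hσ⟩ := hbigW a b hab
    refine ⟨σ, hσ1, fun v ↦ ?_⟩
    have h1 : ((a : AddMonoid.End (E.geomTorsion ℓ)) + (b : AddMonoid.End (E.geomTorsion ℓ)) * φ)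
        ^ 12 = κ (((a : AddMonoid.End (W.geomTorsion ℓ)) +
          (b : AddMonoid.End (W.geomTorsion ℓ)) * φW) ^ 12) := by
      rw [map_pow, map_add, map_mul, map_intCast, map_intCast]
    rw [h1, hκ, ← hσ, heℓσ', eℓ.symm_apply_apply]
  -- the finite image `G`
  haveI : Finite ρ.asGroupHom.range := BigImage.finite_range_asGroupHom ρ hfin
  letI : Fintype ρ.asGroupHom.range := Fintype.ofFinite _
  by_cases hdvd : ℓ ∣ Fintype.card ρ.asGroupHom.range
  · obtain ⟨G, ⟨eG⟩⟩ := BigImage.exists_subgroup_generalLinearGroup_mulEquiv ρ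
    refine Or.inl ⟨_, G, ?_, Finite.of_equiv _ eG.toEquiv, ?_⟩
    · calc Module.finrank ℤ (E.baseChange (AlgebraicClosure ℚ) ⟶ A.baseChange (AlgebraicClosure ℚ))
          ≤ 4 * E.dim * A.dim := hrank
        _ = 4 * A.dim := by rw [hE1, mul_one]
    · rwa [← Nat.card_congr eG.toEquiv, Nat.card_eq_fintype_card]
  right
  -- the plane `V = E[ℓ]`
  letI : Module (ZMod ℓ) (E.geomTorsion ℓ) := AddSubgroup.torsionBy.zmodModule
  haveI : Finite (E.geomTorsion ℓ) := Nat.finite_of_card_ne_zero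
    (by rw [hcard]; exact pow_ne_zero _ hℓ.ne_zero)
  haveI : Nontrivial (E.geomTorsion ℓ) := by
    rw [← Finite.one_lt_card_iff_nontrivial, hcard]
    exact Nat.one_lt_pow two_ne_zero hℓ.one_lt
  have hV : ∀ S : AddSubgroup (E.geomTorsion ℓ),
      (∀ σ : Field.absoluteGaloisGroup ℚ, ∀ v ∈ S, σ • v ∈ S) → S = ⊥ ∨ S = ⊤ := by
    intro S hS
    rcases hirrW W hCM ℓ hℓ hL₂ (S.map eℓ.toAddMonoidHom) (by
        rintro σ _ ⟨v, hv, rfl⟩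
        exact ⟨σ • v, hS σ v hv, heℓσ σ v⟩) with h | h
    · left
      rw [eq_bot_iff]
      intro v hv
      have hm : eℓ v ∈ S.map eℓ.toAddMonoidHom := ⟨v, hv, rfl⟩
      rw [h, AddSubgroup.mem_bot] at hm
      rw [AddSubgroup.mem_bot]
      exact eℓ.map_eq_zero_iff.1 hm
    · right
      rw [eq_top_iff]
      intro v _
      have hm : eℓ v ∈ S.map eℓ.toAddMonoidHom := by rw [h]; trivial
      obtain ⟨v', hv', hvv'⟩ := hm
      rwa [← eℓ.injective hvv']
  -- no invariants
  have hfix' : ∀ f : E.baseChange (AlgebraicClosure ℚ) ⟶ A.baseChange (AlgebraicClosure ℚ),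
      (∀ σ, ρ σ f = f) → f = 0 := fun f hf ↦ by
    obtain ⟨f₀, rfl⟩ := (hfix f).1 hf
    rw [hfree f₀]
    have h := AbelianVariety.Hom.baseChange_add (AlgebraicClosure ℚ) (0 : E ⟶ A) 0
    rw [add_zero] at h
    exact left_eq_add.1 h
  -- `E[ℓ] ↪ A(ℚ̄)` equivariantly
  let ι' : E.geomTorsion ℓ →+ A.geomPoints := ι.comp eℓ.toAddMonoidHom
  have hι'inj : Function.Injective ι' := hιinj.comp eℓ.injective
  have hι'σ : ∀ (σ : Field.absoluteGaloisGroup ℚ) (v : E.geomTorsion ℓ), ι' (σ • v) = σ • ι' v :=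
    fun σ v ↦ by
      change ι (eℓ (σ • v)) = σ • ι (eℓ v)
      rw [heℓσ, hισ]
  -- the corner evaluation
  let ev : (E.baseChange (AlgebraicClosure ℚ) ⟶ A.baseChange (AlgebraicClosure ℚ)) →+
      E.geomPoints →+ A.geomPoints :=
    AddMonoidHom.mk' (fun f ↦ AddMonoidHom.mk' (fun y ↦
      AbelianVariety.Hom.geomPointsMap (biprod.snd : E ⊞ A ⟶ A)
        ((((AddMonoidHom.id (E ⊞ A).geomPoints).comp (MonoidHom.toAdditive ((E ⊞ A).pointsEnd
          (AlgebraicClosure ℚ)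
          (AbelianVariety.Hom.baseChange (AlgebraicClosure ℚ) (biprod.fst : E ⊞ A ⟶ E) ≫ f ≫
            AbelianVariety.Hom.baseChange (AlgebraicClosure ℚ) (biprod.inr : A ⟶ E ⊞ A))))).comp
          (AddMonoidHom.id (E ⊞ A).geomPoints))
          (AbelianVariety.Hom.geomPointsMap (biprod.inl : E ⟶ E ⊞ A) y)))
      (fun y y' ↦ by rw [map_add, map_add, map_add])) (fun f g ↦ by
      ext y
      simp only [AddMonoidHom.add_apply, AddMonoidHom.mk'_apply]
      rw [Preadditive.add_comp, Preadditive.comp_add,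
        ← map_add (AbelianVariety.Hom.geomPointsMap (biprod.snd : E ⊞ A ⟶ A))]
      congr 1
      exact BigImage.act_add (E ⊞ A) _ _ _)
  have hev : ∀ (σ : Field.absoluteGaloisGroup ℚ) (f) (y : E.geomPoints),
      ev (ρ σ f) (σ • y) = σ • ev f y := fun σ f y ↦ by
    change AbelianVariety.Hom.geomPointsMap (biprod.snd : E ⊞ A ⟶ A) _ =
      σ • AbelianVariety.Hom.geomPointsMap (biprod.snd : E ⊞ A ⟶ A) _
    rw [hρ σ f]
    exact BigImage.corner_ev_smul E A σ f y
  -- `ℓ`-torsion of `A(ℚ̄)` through the corner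
  haveI : Normal ℚ (AlgebraicClosure ℚ) := normal_algebraicClosure_rat
  have hE1' : (E.baseChange (AlgebraicClosure ℚ)).dim = 1 := by
    rw [AbelianVariety.dim_baseChange, hE1]
  obtain ⟨N, hN, hmem⟩ := nsmul_id_mem_closure (E.baseChange (AlgebraicClosure ℚ))
    (A.baseChange (AlgebraicClosure ℚ)) hE1' hiso
  obtain ⟨k, hk⟩ := BigImage.mem_closure_corner E A hN hmem hℓ
  have hsurj : ∃ k : ℕ, ∀ Q : A.geomPoints, ℓ • Q = 0 →
      Q ∈ AddSubgroup.closure {Q' | ∃ (f : E.baseChange (AlgebraicClosure ℚ) ⟶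
        A.baseChange (AlgebraicClosure ℚ)) (y : E.geomPoints), (ℓ ^ k) • y = 0 ∧ Q' = ev f y} :=
    ⟨k, hk⟩
  -- step 0 of the big-image core: the torsion filtration
  let b := Module.finBasis ℤ (E.baseChange (AlgebraicClosure ℚ) ⟶ A.baseChange (AlgebraicClosure ℚ))
  obtain ⟨S, hS, π', hSℓ, hπ's, hπ't⟩ := exists_stable_onto_torsion hV ρ b ev hev ι' hι'inj hι'σ
      hsurj
  -- exponent of the image
  have h2 : ∃ m : ℕ, ¬ ℓ ∣ m ∧ ∀ σ : Field.absoluteGaloisGroup ℚ,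
      LinearMap.toMatrix b b (ρ σ) ^ m = 1 := by
    refine ⟨Fintype.card ρ.asGroupHom.range, hdvd, fun σ ↦ ?_⟩
    have h := pow_card_eq_one (G := ρ.asGroupHom.range) (x := ⟨ρ.asGroupHom σ, σ, rfl⟩)
    have h3 := congrArg (fun u : ρ.asGroupHom.range ↦ ((u : ((E.baseChange (AlgebraicClosure ℚ) ⟶
      A.baseChange (AlgebraicClosure ℚ)) →ₗ[ℤ] (E.baseChange (AlgebraicClosure ℚ) ⟶
      A.baseChange (AlgebraicClosure ℚ)))ˣ) : (E.baseChange (AlgebraicClosure ℚ) ⟶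
      A.baseChange (AlgebraicClosure ℚ)) →ₗ[ℤ] (E.baseChange (AlgebraicClosure ℚ) ⟶
      A.baseChange (AlgebraicClosure ℚ)))) h
    simp only [Subgroup.coe_pow, Subgroup.coe_one, Units.val_pow_eq_pow_val, Units.val_one,
      Representation.asGroupHom_apply] at h3
    rw [LinearMap.toMatrix_pow, h3, LinearMap.toMatrix_one]
  have hm0 : 0 < Fintype.card ρ.asGroupHom.range := Fintype.card_pos
  -- no unipotent elements in the Cartan image
  have h1 : ∀ σ ∈ χ.ker, (∀ v : E.geomTorsion ℓ, σ ^ ℓ • v = v) →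
      ∀ v : E.geomTorsion ℓ, σ • v = v := fun σ hσ hpow ↦
    smul_eq_self_of_pow hℓ2 hcard φ D hφφ hD hns σ
      (fun v ↦ by rw [hsemi, MonoidHom.mem_ker.1 hσ, Units.val_one, one_zsmul]) hpow
  -- the equivariant section
  obtain ⟨j, hj, hjσ⟩ := exists_equivariant_injective ρ b χ.ker h1 h2 S hS π' hSℓ
    hπ's hπ't
  -- the dichotomy
  rcases fixed_or_le (Γ := Field.absoluteGaloisGroup ℚ) (by omega) hcard φ D χ hφφ hD hns
    hsemi hbig (fun σ ↦ LinearMap.toMatrix b b (ρ σ))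
    (by obtain ⟨m, hm, hm'⟩ := h2; exact ⟨m, Nat.pos_of_ne_zero (fun h ↦ hm (h ▸ dvd_zero ℓ)),
      hm, hm'⟩)
    j hj (fun σ hσ v ↦ hjσ σ (MonoidHom.mem_ker.2 hσ) v) with ⟨x, hx, hxσ⟩ | hle
  · -- a `Γ_K`-invariant homomorphism `E_ℚ̄ → A_ℚ̄`: excluded by Faltings and `√D`
    exfalso
    obtain ⟨f, hfinv, hf0⟩ := CMTorsion.exists_invariant_ne_zero ρ b χ.ker hdvd x hx
      (fun σ hσ ↦ hxσ σ (MonoidHom.mem_ker.1 hσ))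
    have hfχ := CMTorsion.smul_eq_units_smul ρ χ hfix' f
      (fun σ hσ ↦ hfinv σ (MonoidHom.mem_ker.2 hσ))
    -- the CM endomorphism of `W` and its character
    obtain ⟨ψ, D', ε, hD'neg, hψψ, hψσ, hψns⟩ := exists_cm_endomorphism W hCM
    -- its restriction to `W[ℓ]`
    have hψmem : ∀ Q : W.geomTorsion ℓ, ψ (Q : W.geomPoints) ∈ W.geomTorsion ℓ := fun Q ↦ by
      have hQ := Q.2
      simp only [Submodule.mem_toAddSubgroup, Submodule.mem_torsionBy_iff] at hQ ⊢
      rw [← map_zsmul, hQ, map_zero]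
    letI : Module (ZMod ℓ) (W.geomTorsion ℓ) := AddSubgroup.torsionBy.zmodModule
    let ψℓ : AddMonoid.End (W.geomTorsion ℓ) :=
      ((ψ : W.geomPoints →+ W.geomPoints).comp (W.geomTorsion ℓ).subtype).codRestrict
        (W.geomTorsion ℓ) (fun Q ↦ hψmem Q)
    have hψℓ : ∀ Q : W.geomTorsion ℓ, ((ψℓ Q : W.geomTorsion ℓ) : W.geomPoints) = ψ Q := fun Q ↦ rfl
    have hεχ : ∀ σ, ε σ = χ σ :=
      units_eq_of_nonscalar (Γ := Field.absoluteGaloisGroup ℚ)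
          (by omega) hcardW φW D χ hφφW hD
        hnsW hχ hsemiW hbigW ψℓ ε
        (fun σ Q ↦ Subtype.ext (by
          rw [hψℓ, Literature.NumberTheory.EllipticCurves.AddSubgroup.torsionBy.coe_smul, hψσ,
            AddSubgroupClass.coe_zsmul,
            Literature.NumberTheory.EllipticCurves.AddSubgroup.torsionBy.coe_smul, hψℓ]))
        (fun c ↦ by
          obtain ⟨Q, hQ, hne⟩ := hψns ℓ hℓ hℓ2 c
          exact ⟨⟨Q, hQ⟩, fun h ↦ hne (by
            have h' := congrArg Subtype.val h
            rw [AddSubgroupClass.coe_zsmul] at h'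
            exact h')⟩)
    -- transport `ψ` to `E(ℚ̄)` along `e`
    let ψE : E.geomPoints →+ E.geomPoints :=
      e.symm.toAddMonoidHom.comp ((ψ : W.geomPoints →+ W.geomPoints).comp e.toAddMonoidHom)
    have hψE : ∀ y, ψE y = e.symm (ψ (e y)) := fun y ↦ rfl
    have he' : ∀ (σ : Field.absoluteGaloisGroup ℚ) (Q : W.geomPoints), e.symm (σ • Q) = σ • e.symm
        Q :=
      fun σ Q ↦ by
        apply e.injective
        rw [he, e.apply_symm_apply, e.apply_symm_apply]
    refine false_of_eigenvector hFal E A hE1 hiso hfree ρ hρ χ f hfχ hf0 ψE D' hD'neg.ne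
      (fun y ↦ by rw [hψE, hψE, e.apply_symm_apply, hψψ, map_zsmul, e.symm_apply_apply])
      (fun σ y ↦ by rw [hψE, hψE, he, hψσ, hεχ, map_zsmul, he'])
  · -- the bound
    have hr : Module.finrank ℤ (E.baseChange (AlgebraicClosure ℚ) ⟶ A.baseChange (AlgebraicClosure
        ℚ))
        ≤ 4 * A.dim := by
      calc Module.finrank ℤ (E.baseChange (AlgebraicClosure ℚ) ⟶ A.baseChange (AlgebraicClosure ℚ))
          ≤ 4 * E.dim * A.dim := hrank
        _ = 4 * A.dim := by rw [hE1, mul_one]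
    have hle' : ℓ ≤ 24 * (4 * A.dim) ^ 2 + 1 :=
      hle.trans (by gcongr)
    have hreal : (ℓ : ℝ) ≤ 24 * (4 * (A.dim : ℝ)) ^ 2 + 1 := by exact_mod_cast hle'
    have hd0 : (0 : ℝ) ≤ A.dim := Nat.cast_nonneg _
    nlinarith

end Summit.ABC.ABC.Theorems.IsotypicMinkowski

end
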